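import Summits.CriticalPhenomena.PercolationContinuityZ3.Theorems.PercNearOneGluingNoHeavyLowerTailThreePartitionGridOrOrTwistedPositivity
import Summits.CriticalPhenomena.PercolationContinuityZ3.Theorems.PercNearOneGluingNoHeavyLowerTailThreePartitionGridBalanced
import Summits.CriticalPhenomena.PercolationContinuityZ3.Theorems.PercNearOneGluingNoHeavyLowerTailThreePartitionGridTerminal
import HarnessLib.Audit

/-!
# `NoHeavyLowerTail` (crux stmt-CriticalPhenomena-4575), master-family hierarchy P3 (gen 36): ONE PRINCIPAL UP-SET — `GridTransport` for `(𝒱, ↑Q)` with `𝒱`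
# ARBITRARY, every twist; hence `N_τ(𝒰, 𝒱, ↑Q) ≥ 0` and Sahi's `E₃(1_U, 1_V, ∏_{q∈Q} ω_q) ≥ 0` (comb-positive) for ALL increasing `U, V`

Support file (seat `prim-masterthm-p3`; `--supports stmt-CriticalPhenomena-4575`; memo
`run/shared/lean/prim/prim-masterthm/FROM-prim-masterthm-p3-g36-CYLINDER-SLACK.md` §11).

THE OBSERVATION.  Let `𝒲 = ↑Q = Set.Ici Q` be principal and `𝒱` any up-set.  The terminal enlargement of `𝒱` against `𝒲` is the `Q`-SHADOW
`𝒱^Q := {v : v ∪ Q ∈ 𝒱}` (an up-set with `𝒱 ⊆ 𝒱^Q` and `𝒱^Q ∩ ↑Q ⊆ 𝒱`, so `∑_𝒰 κ(𝒱^Q, ↑Q) ≤ ∑_𝒰 κ(𝒱, ↑Q)` by V-RED `sum_gtKernel_anti_left`), and the pair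
`(𝒱^Q, ↑Q)` is BALANCED for every twist: un-landing `Q ∖ x₃` from copy 1 to copy 3 (`mvL`, `cp_mvL_rev`) injects the a-sites `{x₁ ∈ 𝒱^Q, Q ⊆ x₁, Q ⊄ x₃}`
into the bad tokens `{x₁ ∈ 𝒱^Q, Q ⊄ x₁, Q ⊆ x₃}` (`card_sites_le_card_bad_shadow_Ici`).  So `typedMatchable_of_balanced` (`…GridBalanced`) gives
`TypedMatchable τ 𝒱^Q (↑Q)` (`typedMatchable_shadow_Ici`), hence `∑_{q∈𝒰} κ_{τ,𝒱,↑Q}(q) ≥ 0` for every grid up-set (`sum_gtKernel_nonneg_Ici`),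
`threePartNT τ 𝒰 𝒱 (↑Q) ≥ 0` for all up-sets `𝒰, 𝒱`, all `Q`, all `τ` (`threePartNT_Ici_nonneg`; any slot, `threePartNT_nonneg_of_Ici`), and through the bridge
`…ThreePartitionCombBridge` (sections of `↑Q` are `∅` or principal, `secFam_Ici`) **`combPos_sahiE_three_Ici` / `sahiE_three_Ici_nonneg`: for all increasing
`U, V ⊆ 2^α` and every `Q ⊆ α`, `p ↦ E₃(μ_p; 1_U, 1_V, 1_{↑Q})` is comb-positive, in particular `≥ 0` under every product measure** — COMB-C3, hence Sahi's
`C₃` on product measures, for every triple containing a principal up-set (an AND of coins).  Seat census beforehand: `(𝒱, ↑Q)` terminalises to nested-or-balanced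
for all up-sets `𝒱 ⊆ 2^[4]` (`e19_classes.py`: 2 520/2 520), `#sites = #bad` for all `𝒱, Q, τ`, `n ≤ 4` (`e20_ici_balanced.py`: 40 320/40 320).
HONEST LABEL: a second closed class of COMB-C3 (after two disjunctions, `…GridOrOrTwistedPositivity`), by REDUCTION to the balanced class already in the kernel;
`TypedGridMatching` / `GridTransport` / COMB-C3 / Sahi's `C₃` for three general increasing events remain OPEN; nothing bears on the (closed) crux. [this work]
-/

noncomputable section

open Finset
open scoped symmDiff Classical

namespace Summit.CriticalPhenomena.PercolationContinuityZ3.Theorems.ThreePartition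

variable {ι : Type*}

/-- **Copies after a reverse `L`-move** (un-landing) of `m ⊆ x₁ ∖ x₃` from copy 1 to copy 3. [this work] -/
theorem cp_mvL_rev (τ : Set ι) {q : Set ι × Set ι} (hq : Disjoint q.1 q.2) {m : Set ι} (hm : m ⊆ cp₁ τ q \ cp₃ τ q) :
    cp₁ τ (mvL q m) = cp₁ τ q \ m ∧ cp₂ τ (mvL q m) = cp₂ τ q ∧ cp₃ τ (mvL q m) = cp₃ τ q ∪ m ∧
      Disjoint (mvL q m).1 (mvL q m).2 := by
  have hd : ∀ c, c ∈ q.1 → c ∈ q.2 → False := fun c h1 h2 => Set.disjoint_left.1 hq h1 h2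
  have hm' : ∀ c, c ∈ m → c ∈ cp₁ τ q ∧ c ∉ cp₃ τ q := fun c hc => hm hc
  simp only [mem_cp₁_iff, mem_cp₃_iff] at hm'
  refine ⟨?_, rfl, ?_, ?_⟩
  · ext c
    simp only [mvL, mem_cp₁_iff, Set.mem_symmDiff, Set.mem_sdiff]
    have := hm' c; have := hd c; tauto
  · ext c
    simp only [mvL, mem_cp₃_iff, Set.mem_symmDiff, Set.mem_union]
    have := hm' c; have := hd c; tauto
  · refine Set.disjoint_left.2 fun c h1 h2 => ?_
    simp only [mvL, Set.mem_symmDiff] at h1 h2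
    have := hm' c; have := hd c; tauto

/-- The `Q`-shadow `{v : v ∪ Q ∈ 𝒱}` of an up-set is an up-set. [this work] -/
theorem isUpperSet_shadow {𝒱 : Set (Set ι)} (h𝒱 : IsUpperSet 𝒱) (Q : Set ι) : IsUpperSet {v : Set ι | v ∪ Q ∈ 𝒱} :=
  fun _ _ hab ha => h𝒱 (Set.union_subset_union_left Q hab) ha

variable [Fintype ι]

/-- **The shadow pair `(𝒱^Q, ↑Q)` is balanced**: un-landing `Q ∖ x₃` injects the a-sites into the bad tokens (every twist). [this work] -/
theorem card_sites_le_card_bad_shadow_Ici (τ : Set ι) (𝒱 : Set (Set ι)) (Q : Set ι) :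
    #((cfgs ι).filter fun q => cp₁ τ q ∈ {v : Set ι | v ∪ Q ∈ 𝒱} ∧ cp₁ τ q ∈ Set.Ici Q ∧ cp₃ τ q ∉ Set.Ici Q)
      ≤ #((cfgs ι).filter fun q => cp₁ τ q ∈ {v : Set ι | v ∪ Q ∈ 𝒱} ∧ cp₁ τ q ∉ Set.Ici Q ∧ cp₃ τ q ∈ Set.Ici Q) := by
  refine card_le_card_of_injOn (fun q => mvL q (Q \ cp₃ τ q)) (fun q hq => ?_) (fun q hq q' hq' h => ?_)
  · rw [mem_coe, mem_filter] at hq ⊢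
    obtain ⟨hq, h1, h2, h3⟩ := hq
    simp only [cfgs, mem_filter, mem_univ, true_and, Set.mem_setOf_eq, Set.mem_Ici] at hq h1 h2 h3 ⊢
    have hm : Q \ cp₃ τ q ⊆ cp₁ τ q \ cp₃ τ q := fun c hc => ⟨h2 hc.1, hc.2⟩
    obtain ⟨e1, -, e3, hd'⟩ := cp_mvL_rev τ hq hm
    refine ⟨hd', ?_, ?_, ?_⟩
    · rw [e1]
      have : cp₁ τ q \ (Q \ cp₃ τ q) ∪ Q = cp₁ τ q := by
        ext c; simp only [Set.mem_union, Set.mem_sdiff]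
        constructor
        · rintro (⟨hc, _⟩ | hc)
          · exact hc
          · exact h2 hc
        · intro hc
          by_cases hcQ : c ∈ Q
          · exact Or.inr hcQ
          · exact Or.inl ⟨hc, fun h => hcQ h.1⟩
      rw [this]
      have hu : cp₁ τ q ∪ Q = cp₁ τ q := Set.union_eq_self_of_subset_right h2
      rw [← hu]; exact h1
    · rw [e1]
      intro hQ
      obtain ⟨c, hcQ, hc3⟩ := Set.not_subset.1 h3
      exact (hQ hcQ).2 ⟨hcQ, hc3⟩
    · rw [e3]
      intro c hc
      by_cases hc3 : c ∈ cp₃ τ q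
      · exact Or.inl hc3
      · exact Or.inr ⟨hc, hc3⟩
  · -- injectivity: the moved set is readable from the image as `Q ∖ (copy 1 of the image)`
    rw [mem_coe, mem_filter] at hq hq'
    obtain ⟨hq0, _, h2, _⟩ := hq
    obtain ⟨hq0', _, h2', _⟩ := hq'
    simp only [cfgs, mem_filter, mem_univ, true_and, Set.mem_Ici] at hq0 hq0' h2 h2'
    have hm : Q \ cp₃ τ q ⊆ cp₁ τ q \ cp₃ τ q := fun c hc => ⟨h2 hc.1, hc.2⟩
    have hm' : Q \ cp₃ τ q' ⊆ cp₁ τ q' \ cp₃ τ q' := fun c hc => ⟨h2' hc.1, hc.2⟩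
    have e1 := (cp_mvL_rev τ hq0 hm).1
    have e1' := (cp_mvL_rev τ hq0' hm').1
    have key : Q \ cp₃ τ q = Q \ cp₃ τ q' := by
      have r1 : Q \ cp₁ τ (mvL q (Q \ cp₃ τ q)) = Q \ cp₃ τ q := by
        rw [e1]; ext c; simp only [Set.mem_sdiff]
        constructor
        · rintro ⟨hcQ, hc⟩
          refine ⟨hcQ, fun hc3 => hc ⟨h2 hcQ, fun h => h.2 hc3⟩⟩
        · rintro ⟨hcQ, hc3⟩
          exact ⟨hcQ, fun h => h.2 ⟨hcQ, hc3⟩⟩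
      have r2 : Q \ cp₁ τ (mvL q' (Q \ cp₃ τ q')) = Q \ cp₃ τ q' := by
        rw [e1']; ext c; simp only [Set.mem_sdiff]
        constructor
        · rintro ⟨hcQ, hc⟩
          refine ⟨hcQ, fun hc3 => hc ⟨h2' hcQ, fun h => h.2 hc3⟩⟩
        · rintro ⟨hcQ, hc3⟩
          exact ⟨hcQ, fun h => h.2 ⟨hcQ, hc3⟩⟩
      rw [← r1, ← r2]
      exact congrArg (fun x => Q \ cp₁ τ x) h
    have := congrArg (fun x => mvL x (Q \ cp₃ τ q)) h
    simp only at this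
    rw [mvL_mvL, key, mvL_mvL] at this
    exact this

/-- **`TypedMatchable τ 𝒱^Q (↑Q)`** for every up-set `𝒱`, every `Q` and every twist (balanced class). [this work] -/
theorem typedMatchable_shadow_Ici (τ : Set ι) {𝒱 : Set (Set ι)} (h𝒱 : IsUpperSet 𝒱) (Q : Set ι) :
    TypedMatchable τ {v : Set ι | v ∪ Q ∈ 𝒱} (Set.Ici Q) :=
  typedMatchable_of_balanced τ (isUpperSet_shadow h𝒱 Q) (isUpperSet_Ici Q) (card_sites_le_card_bad_shadow_Ici τ 𝒱 Q)

/-- **Grid transport for `(τ, 𝒱, ↑Q)`**, `𝒱` an arbitrary up-set: `∑_{q∈𝒰} κ_{τ,𝒱,↑Q}(q) ≥ 0` for every family `𝒰` closed upwards in the grid order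
(matching for the shadow pair, then V-RED). [this work] -/
theorem sum_gtKernel_nonneg_Ici (τ : Set ι) {𝒱 : Set (Set ι)} (h𝒱 : IsUpperSet 𝒱) (Q : Set ι) {𝒰 : Set (Set ι × Set ι)}
    (h𝒰 : ∀ q q' : Set ι × Set ι, q ∈ 𝒰 → q.1 ∆ τ ⊆ q'.1 ∆ τ → q'.2 ∆ τ ⊆ q.2 ∆ τ → q' ∈ 𝒰) :
    0 ≤ ∑ q ∈ (cfgs ι).filter (fun q => q ∈ 𝒰), gtKernel τ 𝒱 (Set.Ici Q) q := by
  refine le_trans (sum_gtKernel_nonneg_of_gtMatchable (gtMatchable_of_typedMatchable (typedMatchable_shadow_Ici τ h𝒱 Q)) h𝒰)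
    (sum_gtKernel_anti_left τ (isUpperSet_Ici Q) (fun v hv => ?_) (fun v hv hvQ => ?_) h𝒰)
  · exact h𝒱 Set.subset_union_left hv
  · have hu : v ∪ Q = v := Set.union_eq_self_of_subset_right hvQ
    have hv' : v ∪ Q ∈ 𝒱 := hv
    rwa [hu] at hv'

/-- **`N_τ(𝒰, 𝒱, ↑Q) ≥ 0`** for every twist, all up-sets `𝒰, 𝒱` and every `Q`. [this work] -/
theorem threePartNT_Ici_nonneg (τ : Set ι) {𝒰 𝒱 : Set (Set ι)} (h𝒰 : IsUpperSet 𝒰) (h𝒱 : IsUpperSet 𝒱) (Q : Set ι) :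
    0 ≤ threePartNT τ 𝒰 𝒱 (Set.Ici Q) := by
  rw [threePartNT_eq_sum_filter]
  refine sum_gtKernel_nonneg_Ici τ h𝒱 Q fun q q' hq h1 _ => ?_
  rw [mem_cyl] at hq ⊢
  exact h𝒰 h1 hq

/-- **Twisted three-partition positivity with a principal up-set in any slot.** [this work] -/
theorem threePartNT_nonneg_of_Ici (τ : Set ι) {𝒰 𝒱 𝒲 : Set (Set ι)} (h𝒰 : IsUpperSet 𝒰) (h𝒱 : IsUpperSet 𝒱) (h𝒲 : IsUpperSet 𝒲)
    (h : (∃ Q : Set ι, 𝒲 = Set.Ici Q) ∨ (∃ Q : Set ι, 𝒱 = Set.Ici Q) ∨ (∃ Q : Set ι, 𝒰 = Set.Ici Q)) :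
    0 ≤ threePartNT τ 𝒰 𝒱 𝒲 := by
  rcases h with ⟨Q, rfl⟩ | ⟨Q, rfl⟩ | ⟨Q, rfl⟩
  · exact threePartNT_Ici_nonneg τ h𝒰 h𝒱 Q
  · rw [threePartNT_swap23]
    exact threePartNT_Ici_nonneg τ h𝒰 h𝒲 Q
  · rw [threePartNT_swap12, threePartNT_swap23]
    exact threePartNT_Ici_nonneg τ h𝒱 h𝒲 Q

/-! ## Sahi's `E₃` with a principal up-set is comb-positive on every product cube -/

section Comb

open Literature.Combinatorics.Sahi2008
open SahiComb

variable {α : Type} [Fintype α]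

/-- The section of a principal up-set at a profile: empty if some coordinate of `Q` is closed in all three copies, else the principal up-set of the
active coordinates of `Q`. [this work] -/
theorem secFam_Ici (j : α → ℕ) (Q : Set α) :
    secFam j (Set.Ici Q) = ∅ ∨ secFam j (Set.Ici Q) = Set.Ici {e : Act j | e.1 ∈ Q} := by
  by_cases h0 : ∃ e ∈ Q, ¬ (j e = 1 ∨ j e = 2) ∧ j e ≠ 3
  · left
    obtain ⟨e, heQ, hne, he3⟩ := h0
    refine Set.eq_empty_of_forall_notMem fun T hT => ?_
    have hT' : Q ⊆ liftSet j T := hT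
    exact he3 ((mem_liftSet_iff_of_not hne).1 (hT' heQ))
  · right
    have h0' : ∀ e, e ∈ Q → ¬ (j e = 1 ∨ j e = 2) → j e = 3 := fun e he hne => by
      by_contra h3; exact h0 ⟨e, he, hne, h3⟩
    ext T
    show Q ⊆ liftSet j T ↔ {e : Act j | e.1 ∈ Q} ⊆ T
    constructor
    · intro hQT e he
      exact (val_mem_liftSet_iff e).1 (hQT he)
    · intro hT e heQ
      by_cases he : j e = 1 ∨ j e = 2
      · exact (mem_liftSet_iff he).2 (hT (show (⟨e, he⟩ : Act j) ∈ {e : Act j | e.1 ∈ Q} from heQ))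
      · exact (mem_liftSet_iff_of_not he).2 (h0' e heQ he)

/-- **COMB-C3 with a principal up-set**: for all increasing `U, V` and every `Q`, `p ↦ E₃(μ_p; 1_U, 1_V, 1_{↑Q})` is a nonnegative combination of the
degree-3 tensor-Bernstein basis on the product cube. [this work] -/
theorem combPos_sahiE_three_Ici {U V : Set (Set α)} (hU : IsUpperSet U) (hV : IsUpperSet V) (Q : Set α) :
    CombPos (fun _ : α => 3) (fun p => sahiE (bernoulliWeight p) 3
      ![Literature.Probability.Percolation.DecisionTree.ind U, Literature.Probability.Percolation.DecisionTree.ind V,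
        Literature.Probability.Percolation.DecisionTree.ind (Set.Ici Q)]) := by
  refine combPos_sahiE_three_of_combCoef3_nonneg fun j => ?_
  by_cases hj : ∀ e, j e ≤ 3
  · rw [combCoef3_eq_threePartNT U V (Set.Ici Q) hj]
    rcases secFam_Ici j Q with h | h
    · rw [h]
      exact_mod_cast threePartNT_nonneg_of_nested (twist j) (isUpperSet_secFam j hU) (isUpperSet_secFam j hV) isUpperSet_empty
        (Or.inr (Or.inl (Set.empty_subset _)))
    · rw [h]
      exact_mod_cast threePartNT_Ici_nonneg (twist j) (isUpperSet_secFam j hU) (isUpperSet_secFam j hV) _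
  · rw [combCoef3_eq_zero_of_not_le U V (Set.Ici Q) hj]

/-- **Sahi's `E₃ ≥ 0` for (increasing, increasing, AND of coins) under every product measure.** [this work] -/
theorem sahiE_three_Ici_nonneg {U V : Set (Set α)} (hU : IsUpperSet U) (hV : IsUpperSet V) (Q : Set α) (p : α → unitInterval) :
    0 ≤ sahiE (bernoulliWeight p) 3
      ![Literature.Probability.Percolation.DecisionTree.ind U, Literature.Probability.Percolation.DecisionTree.ind V,
        Literature.Probability.Percolation.DecisionTree.ind (Set.Ici Q)] :=
  (combPos_sahiE_three_Ici hU hV Q).nonneg p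

end Comb

end Summit.CriticalPhenomena.PercolationContinuityZ3.Theorems.ThreePartition

end
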